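import Mathlib
import Summits.CriticalPhenomena.PercolationContinuityZ3.Theorems.PercNearOneGluingNoHeavyLowerTailOddsBernstein
import HarnessLib

/-!
# THEOREM H′: `1/₂F₁(−θ,−m;c;g)` is completely monotone for every `θ ∈ (0,2]` at EVERY level `c > 0`

Support file for the Sahi / Conjecture-P programme of route `PercNearOneGluingNoHeavy`
(`--supports stmt-CriticalPhenomena-4575`, prover prim-l12-p5 gen 38; proof note
`prim-l12-p5/PROOF-REGION-II-RENEWAL-g38.md` §1, §4.3).  No definitions, no named facts, no sorries.

THEOREM H (g36, `hypergeom_inv_cm`) gives complete monotonicity of `m ↦ 1/₂F₁(−θ,−m;c;g)` for `c ≥ 1`, and g37's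
`hyp_inv_altSum_aux'` for `c ≥ 1 − θ₀` (`θ = θ₀ + n`, `θ₀ ∈ (0,1]`).  In Region II of CONJECTURE A′ (`θ ∈ (1,2)`, level
`c = γ < 1 − θ₀ = 2 − θ`) neither applies, and THEOREM H's mechanism is absent there (`Q_{θ−1}/Q_θ` is not CM below the
line).  This file proves the reciprocal statement nevertheless, for all `θ ∈ (0,2]` and all `c > 0`, from the gen-38
FACTORISATION
  `c · Q_θ(m) = P_ϑ(m) · G(m)`,  `G(m) = c + g m + ϑ(1−g)·(1 − P_{ϑ−1}(m)/P_ϑ(m))`  (`θ = ϑ+1`, `Q` at level `c`, `P` at level `c+1`),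
obtained from the c-split `c·H a c r = (c−a)·H a (c+1) r + a·H (a+1) (c+1) r` (`hyp_csplit`, g36) and Gauss' contiguous
relation (`hyp_gauss`):
`G` is a positive sequence with completely monotone first difference `g + ϑ(1−g)(r(m) − r(m+1))`, `r = P_{ϑ−1}/P_ϑ` being CM at
level `c+1 ≥ 1 − ϑ` (`hyp_inv_altSum_aux'`), so `1/G` is CM (LEMMA DB) and `1/Q_θ = c · (1/P_ϑ) · (1/G)` is CM (Leibniz).
In the memo's language `G = γ Q_θ/P_ϑ` is the Laplace exponent of the killed drifted compound-Poisson subordinator whose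
γ-tilted potential density Φ decides Region II (BASE-II ⟺ Φ non-increasing); the present file is the kernel form of
"`G` is a (discrete) Bernstein function" and of its first consequence, CONJECTURE H′ for `θ ≤ 2` (numerically T3).

Main statements (hypothesis-definition `H a c r = Σ_k C(r,k)(−g)^k (a)_k/(c)_k` as in the g36/g37 files):
* `hyp_G_factor`           — `c·H (−ϑ−1) c r = (c + ϑ + (r − ϑ)g)·H (−ϑ) (c+1) r − ϑ(1−g)·H (1−ϑ) (c+1) r`;
* `hyp_G_diff_altSum_nonneg`, `hyp_G_pos` — `G` has CM first difference and is positive;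
* `hyp_inv_altSum_nonneg_le_one_anylevel` — `1/H(−ϑ) c` is CM for `ϑ ∈ (0,1]`, every `c > 0`;
* **`hyp_inv_altSum_nonneg_le_two_anylevel`** — `1/H(−ϑ−1) c` is CM for `ϑ ∈ (0,1]`, every `c > 0` (THEOREM H′).
-/

namespace Summit.CriticalPhenomena.PercolationContinuityZ3.Theorems

namespace HypergeomCM

open Finset MomentRatioTN
open scoped Nat

section

variable (g : ℝ) (H : ℝ → ℝ → ℕ → ℝ)
  (hH : ∀ a c r, H a c r = ∑ k ∈ range (r + 1), (r.choose k : ℝ) * (-g) ^ k *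
    ((∏ i ∈ range k, (a + i)) / (∏ i ∈ range k, (c + i))))
include hH

/-- **The factorisation** `c·Q_θ = P_ϑ·G` written out (`θ = ϑ+1`, `Q` at level `c`, `P` at level `c+1`):
`c·H (−ϑ−1) c r = (c + ϑ + (r − ϑ) g)·H (−ϑ) (c+1) r − ϑ(1−g)·H (1−ϑ) (c+1) r`. -/
theorem hyp_G_factor (ϑ c : ℝ) (hc : 0 < c) (r : ℕ) :
    c * H (-ϑ - 1) c r =
      (c + ϑ + ((r : ℝ) - ϑ) * g) * H (-ϑ) (c + 1) r - ϑ * (1 - g) * H (1 - ϑ) (c + 1) r := by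
  have h1 := hyp_csplit g H hH (-ϑ - 1) c hc r
  have h2 := hyp_gauss g H hH r (-ϑ) (c + 1) (by linarith)
  rw [show -ϑ - 1 + 1 = -ϑ by ring] at h1
  rw [show -ϑ - 1 = -ϑ - 1 by rfl, show -ϑ + 1 = 1 - ϑ by ring] at h2
  linear_combination h1 + h2

/-- `1/₂F₁(−ϑ,−m;c;g)` is completely monotone for `ϑ ∈ (0,1]` and EVERY `c > 0` (g37's `hyp_inv_altSum_aux'` asked for
`c ≥ 1 − ϑ`, which is only needed for its ratio part): the first difference of `H (−ϑ) c` is `(ϑg/c)·H (1−ϑ) (c+1)`,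
completely monotone by `hyp_altSum_nonneg` (`0 ≤ 1−ϑ ≤ c+1` always), and LEMMA DB applies. -/
theorem hyp_inv_altSum_nonneg_le_one_anylevel (hg0 : 0 ≤ g) (hg1 : g < 1) (c : ℝ) (hc : 0 < c) (ϑ : ℝ)
    (h0 : 0 < ϑ) (h1 : ϑ ≤ 1) (k j : ℕ) :
    0 ≤ ∑ i ∈ range (k + 1), (-1 : ℝ) ^ i * (k.choose i : ℝ) * (H (-ϑ) c (j + i))⁻¹ := by
  have hP : ∀ r, 0 < H (-ϑ) c r := fun r => hyp_pos g H hH hg0 hg1 (-ϑ) r c hc (by linarith)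
  have hΔ : ∀ r, H (-ϑ) c (r + 1) - H (-ϑ) c r = ϑ * g / c * H (1 - ϑ) (c + 1) r := by
    intro r
    have hs := hyp_step g H hH (-ϑ) c hc r
    rw [show -ϑ + 1 = 1 - ϑ by ring] at hs
    field_simp
    linear_combination hs
  refine altSum_inv_nonneg (fun r => H (-ϑ) c r) hP (fun k j => ?_) k j
  simp_rw [hΔ]
  rw [altSum_const_mul]
  exact mul_nonneg (div_nonneg (mul_nonneg h0.le hg0) hc.le)
    (hyp_altSum_nonneg g H hH hg0 hg1 (1 - ϑ) (c + 1) (by linarith) (by linarith) (by linarith) k j)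

/-- `G(m) := c·Q_θ(m)/P_ϑ(m) = c + ϑ + (m − ϑ)g − ϑ(1−g)·P_{ϑ−1}(m)/P_ϑ(m)` is positive (`ϑ ∈ (0,1]`, `c > 0`, `0 ≤ g < 1`). -/
theorem hyp_G_pos (hg0 : 0 ≤ g) (hg1 : g < 1) (c : ℝ) (hc : 0 < c) (ϑ : ℝ) (h0 : 0 < ϑ) (r : ℕ) :
    0 < c * H (-ϑ - 1) c r * (H (-ϑ) (c + 1) r)⁻¹ := by
  have hQ : 0 < H (-ϑ - 1) c r := hyp_pos g H hH hg0 hg1 (-ϑ - 1) r c hc (by linarith)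
  have hP : 0 < H (-ϑ) (c + 1) r := hyp_pos g H hH hg0 hg1 (-ϑ) r (c + 1) (by linarith) (by linarith)
  positivity

/-- `G` has completely monotone first difference: `G(m+1) − G(m) = g + ϑ(1−g)·(r(m) − r(m+1))`,
`r = P_{ϑ−1}/P_ϑ` completely monotone at level `c+1 ≥ 1−ϑ` (`hyp_inv_altSum_aux'`). -/
theorem hyp_G_diff_altSum_nonneg (hg0 : 0 ≤ g) (hg1 : g < 1) (c : ℝ) (hc : 0 < c) (ϑ : ℝ) (h0 : 0 < ϑ)
    (h1 : ϑ ≤ 1) (k j : ℕ) :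
    0 ≤ ∑ i ∈ range (k + 1), (-1 : ℝ) ^ i * (k.choose i : ℝ) *
      (c * H (-ϑ - 1) c (j + i + 1) * (H (-ϑ) (c + 1) (j + i + 1))⁻¹ -
        c * H (-ϑ - 1) c (j + i) * (H (-ϑ) (c + 1) (j + i))⁻¹) := by
  have hP : ∀ r, 0 < H (-ϑ) (c + 1) r := fun r =>
    hyp_pos g H hH hg0 hg1 (-ϑ) r (c + 1) (by linarith) (by linarith)
  -- G in closed form
  have hG : ∀ r : ℕ, c * H (-ϑ - 1) c r * (H (-ϑ) (c + 1) r)⁻¹ =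
      (c + ϑ + ((r : ℝ) - ϑ) * g) - ϑ * (1 - g) * (H (1 - ϑ) (c + 1) r * (H (-ϑ) (c + 1) r)⁻¹) := by
    intro r
    have hf := hyp_G_factor g H hH ϑ c hc r
    have h0' := (hP r).ne'
    field_simp
    linear_combination hf
  have hΔG : ∀ r : ℕ, c * H (-ϑ - 1) c (r + 1) * (H (-ϑ) (c + 1) (r + 1))⁻¹ -
      c * H (-ϑ - 1) c r * (H (-ϑ) (c + 1) r)⁻¹ =
      g + ϑ * (1 - g) * (H (1 - ϑ) (c + 1) r * (H (-ϑ) (c + 1) r)⁻¹ -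
        H (1 - ϑ) (c + 1) (r + 1) * (H (-ϑ) (c + 1) (r + 1))⁻¹) := by
    intro r
    rw [hG (r + 1), hG r]
    push_cast
    ring
  simp_rw [hΔG]
  rw [altSum_const_add_mul g (ϑ * (1 - g))
    (fun r => H (1 - ϑ) (c + 1) r * (H (-ϑ) (c + 1) r)⁻¹ - H (1 - ϑ) (c + 1) (r + 1) * (H (-ϑ) (c + 1) (r + 1))⁻¹) k j]
  have hk : ∑ i ∈ range (k + 1), (-1 : ℝ) ^ i * (k.choose i : ℝ) *
      (H (1 - ϑ) (c + 1) (j + i) * (H (-ϑ) (c + 1) (j + i))⁻¹ -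
        H (1 - ϑ) (c + 1) (j + i + 1) * (H (-ϑ) (c + 1) (j + i + 1))⁻¹) =
      ∑ i ∈ range (k + 2), (-1 : ℝ) ^ i * ((k + 1).choose i : ℝ) *
        (H (1 - ϑ) (c + 1) (j + i) * (H (-ϑ) (c + 1) (j + i))⁻¹) :=
    (altSum_succ (fun r => H (1 - ϑ) (c + 1) r * (H (-ϑ) (c + 1) r)⁻¹) k j).symm
  rw [hk]
  -- the ratio r = P_{ϑ-1}/P_ϑ is CM at level c+1 (Region-I base case: 1 - ϑ ≤ c + 1)
  have hB := (hyp_inv_altSum_aux' g H hH hg0 hg1 (c + 1) (by linarith) ϑ h0 h1 (by linarith) 0).2 (k + 1) j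
  simp only [Nat.cast_zero, add_zero] at hB
  have : (0 : ℝ) ≤ (1 - 1) ^ k := pow_nonneg (by norm_num) k
  have hB0 : 0 ≤ ϑ * (1 - g) := mul_nonneg h0.le (by linarith)
  positivity

/-- **THEOREM H′ (θ ∈ (1,2], every level).**  For `ϑ ∈ (0,1]`, `c > 0`, `0 ≤ g < 1` the sequence
`m ↦ 1/₂F₁(−(ϑ+1),−m;c;g)` is completely monotone.  Proof: `1/Q_θ = c·(1/P_ϑ)·(1/G)` with `1/P_ϑ` CM
(`hyp_inv_altSum_nonneg_le_one_anylevel` at level `c+1`), `1/G` CM (LEMMA DB with `hyp_G_diff_altSum_nonneg`,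
`hyp_G_pos`), and Leibniz. -/
theorem hyp_inv_altSum_nonneg_le_two_anylevel (hg0 : 0 ≤ g) (hg1 : g < 1) (c : ℝ) (hc : 0 < c) (ϑ : ℝ)
    (h0 : 0 < ϑ) (h1 : ϑ ≤ 1) (k j : ℕ) :
    0 ≤ ∑ i ∈ range (k + 1), (-1 : ℝ) ^ i * (k.choose i : ℝ) * (H (-ϑ - 1) c (j + i))⁻¹ := by
  have hP : ∀ r, 0 < H (-ϑ) (c + 1) r := fun r =>
    hyp_pos g H hH hg0 hg1 (-ϑ) r (c + 1) (by linarith) (by linarith)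
  have hQ : ∀ r, 0 < H (-ϑ - 1) c r := fun r => hyp_pos g H hH hg0 hg1 (-ϑ - 1) r c hc (by linarith)
  set G : ℕ → ℝ := fun r => c * H (-ϑ - 1) c r * (H (-ϑ) (c + 1) r)⁻¹ with hGdef
  have hGinv : ∀ k j, 0 ≤ ∑ i ∈ range (k + 1), (-1 : ℝ) ^ i * (k.choose i : ℝ) * (G (j + i))⁻¹ :=
    altSum_inv_nonneg G (fun r => hyp_G_pos g H hH hg0 hg1 c hc ϑ h0 r)
      (fun k j => hyp_G_diff_altSum_nonneg g H hH hg0 hg1 c hc ϑ h0 h1 k j)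
  have hPinv : ∀ k j, 0 ≤ ∑ i ∈ range (k + 1), (-1 : ℝ) ^ i * (k.choose i : ℝ) * (H (-ϑ) (c + 1) (j + i))⁻¹ :=
    fun k j => hyp_inv_altSum_nonneg_le_one_anylevel g H hH hg0 hg1 (c + 1) (by linarith) ϑ h0 h1 k j
  -- 1/Q = c · (1/P) · (1/G)
  have e : ∀ r, (H (-ϑ - 1) c r)⁻¹ = c * ((H (-ϑ) (c + 1) r)⁻¹ * (G r)⁻¹) := by
    intro r
    simp only [hGdef]
    have h1' := (hP r).ne'
    have h2' := (hQ r).ne'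
    have hc' := hc.ne'
    field_simp
  have hsum : (∑ i ∈ range (k + 1), (-1 : ℝ) ^ i * (k.choose i : ℝ) * (H (-ϑ - 1) c (j + i))⁻¹) =
      c * ∑ i ∈ range (k + 1), (-1 : ℝ) ^ i * (k.choose i : ℝ) *
        ((H (-ϑ) (c + 1) (j + i))⁻¹ * (G (j + i))⁻¹) := by
    rw [mul_sum]
    exact sum_congr rfl fun i _ => by rw [e (j + i)]; ring
  rw [hsum]
  exact mul_nonneg hc.le (altSum_mul_nonneg (fun r => (H (-ϑ) (c + 1) r)⁻¹) (fun r => (G r)⁻¹) hPinv hGinv k j)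

end

/-- **THEOREM H′, closed form.**  For `θ ∈ (1,2]`, `c > 0`, `0 ≤ g < 1` and all `k, j`:
`Σ_{i≤k} (−1)^i C(k,i) / ₂F₁(−θ, −(j+i); c; g) ≥ 0`, the Gauss sum written out as
`₂F₁(−θ,−r;c;g) = Σ_{l≤r} C(r,l) (−g)^l ∏_{i<l}(−θ+i)/∏_{i<l}(c+i)`.  (For `θ ∈ (0,1]` see
`hyp_inv_altSum_nonneg_le_one_anylevel`; for `c ≥ 1` and all `θ > 0` this is g36's `hypergeom_inv_cm`.) -/
theorem hypergeom_inv_cm_le_two_anylevel (θ c g : ℝ) (hθ1 : 1 < θ) (hθ2 : θ ≤ 2) (hc : 0 < c) (hg0 : 0 ≤ g)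
    (hg1 : g < 1) (k j : ℕ) :
    0 ≤ ∑ i ∈ range (k + 1), (-1 : ℝ) ^ i * (k.choose i : ℝ) *
      (∑ l ∈ range (j + i + 1), ((j + i).choose l : ℝ) * (-g) ^ l *
        ((∏ m ∈ range l, (-θ + m)) / (∏ m ∈ range l, (c + m))))⁻¹ := by
  set H : ℝ → ℝ → ℕ → ℝ := fun a c r => ∑ l ∈ range (r + 1), (r.choose l : ℝ) * (-g) ^ l *
    ((∏ m ∈ range l, (a + m)) / (∏ m ∈ range l, (c + m))) with hHdef
  have hH : ∀ a c r, H a c r = ∑ l ∈ range (r + 1), (r.choose l : ℝ) * (-g) ^ l *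
      ((∏ m ∈ range l, (a + m)) / (∏ m ∈ range l, (c + m))) := fun a c r => rfl
  have main := hyp_inv_altSum_nonneg_le_two_anylevel g H hH hg0 hg1 c hc (θ - 1) (by linarith) (by linarith) k j
  have e : -(θ - 1) - 1 = -θ := by ring
  rw [e] at main
  simpa only [hHdef] using main

end HypergeomCM

end Summit.CriticalPhenomena.PercolationContinuityZ3.Theorems
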